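import Summits.Ventures.PercRepro.RankLevelSetSpanningCount

/-!
# PercRepro — THE SPANNING TAIL CUT BY THE TRIANGLES (p8 g14, S3): the `Y` side of the level-6 cell

`Proposition C₀ (Y)` counts the spanning sets of a matroid of nullity `d` by their complements, `Σ_{j ≤ d} C(n, j)`
(`ncard_spanning_le`). A spanning set of nullity `0` is a basis and contains no circuit; one of nullity `1` contains at most
one of any two distinct triangles, two distinct triangles having union nullity `≥ 2` (`eRk_union_add_two_le_of_two_triangles`:
a circuit not inside `A` raises the nullity, `eRk_union_circuit_add_le`, and nullity is monotone,
`eRk_add_le_encard_of_subset`). Hence the complements of the spanning sets of size `d` meet every triangle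
(`diff_inter_nonempty_of_spanning_of_encard`), those of size `d − 1` miss at most one of two
(`diff_inter_nonempty_or_of_spanning_of_encard_succ`), and the tail becomes
`Σ_{j ≤ d−2} C(n, j) + (C(n, d−1) − C(n − |T₁ ∪ T₂|, d−1)) + (C(n, d) − 2·C(n − 3, d) + C(n − |T₁ ∪ T₂|, d))`:
**`ncard_spanning_le_two_triangles`** (additively in `ℕ`, with `5 ≤ |T₁ ∪ T₂| ≤ 6`). The three-triangle form is
RankLevelSetSpanningThreeTriangles. Axioms: standard.
-/

namespace PercRepro

open Finset Set

variable {α : Type*}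

/-! ### Nullity and circuits -/

namespace Matroid

variable {M : _root_.Matroid α}

/-- **A circuit not inside `A` raises the nullity**: `r(A ∪ C) + |A ∩ C| + 1 ≤ r(A) + |C|` (submodularity, `A ∩ C ⊊ C`
independent, `r(C) + 1 = |C|`). -/
theorem eRk_union_circuit_add_le {A C : Set α} (hC : M.IsCircuit C) (hCA : ¬ C ⊆ A) :
    M.eRk (A ∪ C) + (A ∩ C).encard + 1 ≤ M.eRk A + C.encard := by
  have hssub : A ∩ C ⊂ C := by
    refine (Set.inter_subset_right).ssubset_of_ne ?_
    intro h
    exact hCA (h ▸ Set.inter_subset_left)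
  have h2 : M.eRk (A ∩ C) = (A ∩ C).encard := (hC.ssubset_indep hssub).eRk_eq_encard
  have h1 := M.eRk_inter_add_eRk_union_le A C
  have h3 := hC.eRk_add_one_eq
  calc M.eRk (A ∪ C) + (A ∩ C).encard + 1 = (M.eRk (A ∩ C) + M.eRk (A ∪ C)) + 1 := by
        rw [h2, add_comm (M.eRk (A ∪ C))]
    _ ≤ (M.eRk A + M.eRk C) + 1 := by gcongr
    _ = M.eRk A + C.encard := by rw [add_assoc, h3]

/-- **Nullity is monotone**: `r(S) + k ≤ |S|` and `S ⊆ X` give `r(X) + k ≤ |X|`. -/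
theorem eRk_add_le_encard_of_subset {S X : Set α} {k : ℕ∞} (hSX : S ⊆ X) (h : M.eRk S + k ≤ S.encard) :
    M.eRk X + k ≤ X.encard := by
  have h1 : M.eRk X ≤ M.eRk S + (X \ S).encard := by
    have := M.eRk_union_le_eRk_add_encard S (X \ S)
    rwa [Set.union_sdiff_cancel hSX] at this
  have h2 : (X \ S).encard + S.encard = X.encard := Set.encard_sdiff_add_encard_of_subset hSX
  calc M.eRk X + k ≤ M.eRk S + (X \ S).encard + k := by gcongr
    _ = (M.eRk S + k) + (X \ S).encard := by ring
    _ ≤ S.encard + (X \ S).encard := by gcongr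
    _ = X.encard := by rw [add_comm, h2]

/-- A circuit `C ⊆ E` missed by the complement of `X` lies inside `X`. -/
theorem subset_of_diff_inter_eq_empty {X C : Set α} (hCE : C ⊆ M.E) (h : (M.E \ X) ∩ C = ∅) : C ⊆ X := by
  intro x hx
  by_contra hxX
  have hmem : x ∈ (M.E \ X) ∩ C := ⟨⟨hCE hx, hxX⟩, hx⟩
  rw [h] at hmem
  exact (Set.mem_empty_iff_false x).1 hmem

variable [M.Finite]

/-- **Two distinct triangles have union nullity `≥ 2`**: `r(T₁ ∪ T₂) + 2 ≤ |T₁ ∪ T₂|`. -/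
theorem eRk_union_add_two_le_of_two_triangles {T₁ T₂ : Set α} (h1 : M.IsCircuit T₁) (h2 : M.IsCircuit T₂)
    (hne : T₁ ≠ T₂) : M.eRk (T₁ ∪ T₂) + 2 ≤ (T₁ ∪ T₂).encard := by
  have hT2 : ¬ T₂ ⊆ T₁ := fun h => hne (h2.eq_of_subset_isCircuit h1 h).symm
  have hA := eRk_union_circuit_add_le (A := T₁) h2 hT2
  have h3 := h1.eRk_add_one_eq
  have hu := Set.encard_union_add_encard_inter T₁ T₂
  have hfin : (T₁ ∩ T₂).encard ≠ ⊤ :=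
    ((M.ground_finite.subset h1.subset_ground).subset Set.inter_subset_left).encard_lt_top.ne
  have key : M.eRk (T₁ ∪ T₂) + 2 + (T₁ ∩ T₂).encard ≤ (T₁ ∪ T₂).encard + (T₁ ∩ T₂).encard := by
    calc M.eRk (T₁ ∪ T₂) + 2 + (T₁ ∩ T₂).encard = (M.eRk (T₁ ∪ T₂) + (T₁ ∩ T₂).encard + 1) + 1 := by ring
      _ ≤ (M.eRk T₁ + T₂.encard) + 1 := by gcongr
      _ = (M.eRk T₁ + 1) + T₂.encard := by ring
      _ = T₁.encard + T₂.encard := by rw [h3]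
      _ = (T₁ ∪ T₂).encard + (T₁ ∩ T₂).encard := hu.symm
  exact (ENat.add_le_add_iff_right hfin).1 key

/-- **Three triangles meeting pairwise in at most one point have union nullity `≥ 3`**:
`r(T₁ ∪ T₂ ∪ T₃) + 3 ≤ |T₁ ∪ T₂ ∪ T₃|` (`T₃ ⊄ T₁ ∪ T₂` since `|T₃ ∩ (T₁ ∪ T₂)| ≤ 2`). -/
theorem eRk_union_add_three_le_of_three_triangles {T₁ T₂ T₃ : Set α}
    (h1 : M.IsCircuit T₁) (h2 : M.IsCircuit T₂) (h3 : M.IsCircuit T₃) (h12 : T₁ ≠ T₂)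
    (hc3 : T₃.ncard = 3) (h13 : (T₁ ∩ T₃).ncard ≤ 1) (h23 : (T₂ ∩ T₃).ncard ≤ 1) :
    M.eRk (T₁ ∪ T₂ ∪ T₃) + 3 ≤ (T₁ ∪ T₂ ∪ T₃).encard := by
  have hA2 := eRk_union_add_two_le_of_two_triangles h1 h2 h12
  have hT3 : ¬ T₃ ⊆ T₁ ∪ T₂ := by
    intro h
    have heq : T₃ = (T₁ ∩ T₃) ∪ (T₂ ∩ T₃) := by
      ext x
      constructor
      · intro hx
        rcases h hx with h' | h'
        · exact Or.inl ⟨h', hx⟩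
        · exact Or.inr ⟨h', hx⟩
      · rintro (⟨_, hx⟩ | ⟨_, hx⟩) <;> exact hx
    have hle := Set.ncard_union_le (T₁ ∩ T₃) (T₂ ∩ T₃)
    rw [← heq] at hle
    omega
  have hA := eRk_union_circuit_add_le (A := T₁ ∪ T₂) h3 hT3
  have hu := Set.encard_union_add_encard_inter (T₁ ∪ T₂) T₃
  have hfin : ((T₁ ∪ T₂) ∩ T₃).encard ≠ ⊤ :=
    ((M.ground_finite.subset h3.subset_ground).subset Set.inter_subset_right).encard_lt_top.ne
  have key : M.eRk (T₁ ∪ T₂ ∪ T₃) + 3 + ((T₁ ∪ T₂) ∩ T₃).encard ≤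
      (T₁ ∪ T₂ ∪ T₃).encard + ((T₁ ∪ T₂) ∩ T₃).encard := by
    calc M.eRk (T₁ ∪ T₂ ∪ T₃) + 3 + ((T₁ ∪ T₂) ∩ T₃).encard
        = (M.eRk ((T₁ ∪ T₂) ∪ T₃) + ((T₁ ∪ T₂) ∩ T₃).encard + 1) + 2 := by ring
      _ ≤ (M.eRk (T₁ ∪ T₂) + T₃.encard) + 2 := by gcongr
      _ = (M.eRk (T₁ ∪ T₂) + 2) + T₃.encard := by ring
      _ ≤ (T₁ ∪ T₂).encard + T₃.encard := by gcongr
      _ = (T₁ ∪ T₂ ∪ T₃).encard + ((T₁ ∪ T₂) ∩ T₃).encard := hu.symm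
  exact (ENat.add_le_add_iff_right hfin).1 key

/-- **The complement of a basis meets every circuit.** -/
theorem diff_inter_nonempty_of_spanning_of_encard {X C : Set α} (hX : X ⊆ M.E) (hr : M.eRk X = M.eRank)
    (hcard : X.encard = M.eRank) (hC : M.IsCircuit C) : ((M.E \ X) ∩ C).Nonempty := by
  rw [Set.nonempty_iff_ne_empty]
  intro h
  have hCX : C ⊆ X := subset_of_diff_inter_eq_empty hC.subset_ground h
  have hind : M.Indep X :=
    (_root_.Matroid.indep_iff_eRk_eq_encard_of_finite (M.ground_finite.subset hX)).2 (by rw [hr, hcard])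
  exact hC.dep.not_indep (hind.subset hCX)

/-- **The complement of a spanning set of nullity `1` meets one of any two distinct triangles.** -/
theorem diff_inter_nonempty_or_of_spanning_of_encard_succ {X T₁ T₂ : Set α}
    (hr : M.eRk X = M.eRank) (hcard : X.encard = M.eRank + 1) (h1 : M.IsCircuit T₁) (h2 : M.IsCircuit T₂)
    (hne : T₁ ≠ T₂) : ((M.E \ X) ∩ T₁).Nonempty ∨ ((M.E \ X) ∩ T₂).Nonempty := by
  by_contra h
  rw [not_or, Set.not_nonempty_iff_eq_empty, Set.not_nonempty_iff_eq_empty] at h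
  have hsub : T₁ ∪ T₂ ⊆ X :=
    Set.union_subset (subset_of_diff_inter_eq_empty h1.subset_ground h.1)
      (subset_of_diff_inter_eq_empty h2.subset_ground h.2)
  have hle := eRk_add_le_encard_of_subset hsub (eRk_union_add_two_le_of_two_triangles h1 h2 hne)
  rw [hr, hcard] at hle
  have hR : M.eRank ≠ ⊤ := (M.eRank_ne_top_iff).2 inferInstance
  have h21 : (2 : ℕ∞) ≤ 1 := (ENat.add_le_add_iff_left hR).1 hle
  exact absurd h21 (by decide)

/-- **The complement of a spanning set of nullity `2` meets two of any three triangles meeting pairwise in at most one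
point** (it misses at most one of them). -/
theorem diff_inter_nonempty_two_of_three_of_spanning {X T₁ T₂ T₃ : Set α}
    (hr : M.eRk X = M.eRank) (hcard : X.encard = M.eRank + 2)
    (h1 : M.IsCircuit T₁) (h2 : M.IsCircuit T₂) (h3 : M.IsCircuit T₃) (h12 : T₁ ≠ T₂)
    (hc3 : T₃.ncard = 3) (h13 : (T₁ ∩ T₃).ncard ≤ 1) (h23 : (T₂ ∩ T₃).ncard ≤ 1) :
    ((M.E \ X) ∩ T₁).Nonempty ∨ ((M.E \ X) ∩ T₂).Nonempty ∨ ((M.E \ X) ∩ T₃).Nonempty := by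
  by_contra h
  rw [not_or, not_or, Set.not_nonempty_iff_eq_empty, Set.not_nonempty_iff_eq_empty,
    Set.not_nonempty_iff_eq_empty] at h
  have hsub : T₁ ∪ T₂ ∪ T₃ ⊆ X :=
    Set.union_subset (Set.union_subset (subset_of_diff_inter_eq_empty h1.subset_ground h.1)
      (subset_of_diff_inter_eq_empty h2.subset_ground h.2.1))
      (subset_of_diff_inter_eq_empty h3.subset_ground h.2.2)
  have hle := eRk_add_le_encard_of_subset hsub
    (eRk_union_add_three_le_of_three_triangles h1 h2 h3 h12 hc3 h13 h23)
  rw [hr, hcard] at hle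
  have hR : M.eRank ≠ ⊤ := (M.eRank_ne_top_iff).2 inferInstance
  have h32 : (3 : ℕ∞) ≤ 2 := (ENat.add_le_add_iff_left hR).1 hle
  exact absurd h32 (by decide)

/-! ### The spanning tail with two triangles -/

/-- The complement of a spanning set has at most `d` elements and lies in `E` (the map `X ↦ E ∖ X` is injective). -/
theorem diff_ncard_le_of_spanning {d : ℕ} (hd : M.E.encard = M.eRank + d) {X : Set α} (hX : X ⊆ M.E)
    (hr : M.eRk X = M.eRank) : (M.E \ X).ncard ≤ d ∧ (X.encard + (M.E \ X).encard = M.eRank + d) := by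
  have h1 : M.eRank ≤ X.encard := by rw [← hr]; exact M.eRk_le_encard X
  have h2 : X.encard + (M.E \ X).encard = M.E.encard := by
    rw [add_comm]; exact Set.encard_sdiff_add_encard_of_subset hX
  have hR : M.eRank ≠ ⊤ := (M.eRank_ne_top_iff).2 inferInstance
  have h3 : M.eRank + (M.E \ X).encard ≤ M.eRank + d := by
    calc M.eRank + (M.E \ X).encard ≤ X.encard + (M.E \ X).encard := by gcongr
      _ = M.E.encard := h2
      _ = M.eRank + d := hd
  have h4 : (M.E \ X).encard ≤ d := (ENat.add_le_add_iff_left hR).1 h3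
  have hfin : (M.E \ X).Finite := M.ground_finite.subset Set.sdiff_subset
  refine ⟨?_, by rw [h2, hd]⟩
  rw [← hfin.cast_ncard_eq] at h4
  exact_mod_cast h4

/-- **THE SPANNING TAIL CUT BY TWO TRIANGLES.** In a finite matroid with `|E| = r(E) + d`, `d ≥ 2`, `n = |E|`, and two
distinct triangles `T₁ ≠ T₂` with `|T₁ ∪ T₂| ≥ 5`:
`#spanning + C(n − 6, d − 1) + 2·C(n − 3, d) ≤ Σ_{j ≤ d} C(n, j) + C(n − 5, d)` — the complements of size `d` meet both
triangles, those of size `d − 1` meet one of them. -/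
theorem ncard_spanning_le_two_triangles {d : ℕ} (hd : M.E.encard = M.eRank + d) (hd2 : 2 ≤ d)
    {T₁ T₂ : Set α} (h1 : M.IsCircuit T₁) (h2 : M.IsCircuit T₂) (hne : T₁ ≠ T₂)
    (hc1 : T₁.ncard = 3) (hc2 : T₂.ncard = 3) (hu : 5 ≤ (T₁ ∪ T₂).ncard) :
    {X : Set α | X ⊆ M.E ∧ M.eRk X = M.eRank}.ncard + (M.ground_finite.toFinset.card - 6).choose (d - 1)
        + 2 * (M.ground_finite.toFinset.card - 3).choose d ≤
      (∑ j ∈ Finset.range (d + 1), M.ground_finite.toFinset.card.choose j)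
        + (M.ground_finite.toFinset.card - 5).choose d := by
  classical
  obtain ⟨m, rfl⟩ : ∃ m, d = m + 2 := ⟨d - 2, by omega⟩
  have hE : (M.ground_finite.toFinset : Set α) = M.E := Set.Finite.coe_toFinset _
  have hT1E : T₁ ⊆ M.E := h1.subset_ground
  have hT2E : T₂ ⊆ M.E := h2.subset_ground
  have hT1f : T₁.Finite := M.ground_finite.subset hT1E
  have hT2f : T₂.Finite := M.ground_finite.subset hT2E
  have hS1 : (hT1f.toFinset : Set α) = T₁ := Set.Finite.coe_toFinset _
  have hS2 : (hT2f.toFinset : Set α) = T₂ := Set.Finite.coe_toFinset _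
  have hS1E : hT1f.toFinset ⊆ M.ground_finite.toFinset := by
    rw [← Finset.coe_subset, hS1, hE]; exact hT1E
  have hS2E : hT2f.toFinset ⊆ M.ground_finite.toFinset := by
    rw [← Finset.coe_subset, hS2, hE]; exact hT2E
  have hc1' : hT1f.toFinset.card = 3 := by rw [← hc1, Set.ncard_eq_toFinset_card T₁ hT1f]
  have hc2' : hT2f.toFinset.card = 3 := by rw [← hc2, Set.ncard_eq_toFinset_card T₂ hT2f]
  have hu' : 5 ≤ (hT1f.toFinset ∪ hT2f.toFinset).card := by
    have : ((hT1f.toFinset ∪ hT2f.toFinset : Finset α) : Set α).ncard = (T₁ ∪ T₂).ncard := by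
      rw [Finset.coe_union, hS1, hS2]
    rw [Set.ncard_coe_finset] at this
    omega
  have hu6 : (hT1f.toFinset ∪ hT2f.toFinset).card ≤ 6 := by
    have := Finset.card_union_le hT1f.toFinset hT2f.toFinset
    omega
  have hSU : hT1f.toFinset ∪ hT2f.toFinset ⊆ M.ground_finite.toFinset := Finset.union_subset hS1E hS2E
  set E' := M.ground_finite.toFinset with hE'
  set n := E'.card with hn
  -- the three target families
  set Y₀ := {Y : Set α | Y ⊆ (E' : Set α) ∧ Y.ncard ≤ m} with hY₀
  set Y₁ := {Y : Set α | Y ⊆ (E' : Set α) ∧ Y.ncard = m + 1 ∧ ((Y ∩ T₁).Nonempty ∨ (Y ∩ T₂).Nonempty)} with hY₁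
  set Y₂ := {Y : Set α | Y ⊆ (E' : Set α) ∧ Y.ncard = m + 2 ∧ ((Y ∩ T₁).Nonempty ∧ (Y ∩ T₂).Nonempty)} with hY₂
  have hfin₀ : Y₀.Finite := (E'.finite_toSet.finite_subsets).subset (fun Y hY => hY.1)
  have hfin₁ : Y₁.Finite := (E'.finite_toSet.finite_subsets).subset (fun Y hY => hY.1)
  have hfin₂ : Y₂.Finite := (E'.finite_toSet.finite_subsets).subset (fun Y hY => hY.1)
  -- the complement map
  have hinj : Set.InjOn (fun X : Set α => M.E \ X) {X : Set α | X ⊆ M.E ∧ M.eRk X = M.eRank} := by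
    intro X hX Y hY hXY
    simp only at hXY
    rw [← Set.sdiff_sdiff_cancel_left hX.1, hXY, Set.sdiff_sdiff_cancel_left hY.1]
  have hmaps : ∀ X ∈ {X : Set α | X ⊆ M.E ∧ M.eRk X = M.eRank},
      (fun X : Set α => M.E \ X) X ∈ Y₀ ∪ Y₁ ∪ Y₂ := by
    intro X hX
    show M.E \ X ∈ Y₀ ∪ Y₁ ∪ Y₂
    obtain ⟨hle, hsum⟩ := diff_ncard_le_of_spanning hd hX.1 hX.2
    have hYE : M.E \ X ⊆ (E' : Set α) := by rw [hE]; exact Set.sdiff_subset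
    have hfinY : (M.E \ X).Finite := M.ground_finite.subset Set.sdiff_subset
    have hcastY : (M.E \ X).encard = ((M.E \ X).ncard : ℕ∞) := hfinY.cast_ncard_eq.symm
    rcases Nat.lt_or_ge (M.E \ X).ncard (m + 1) with hlt | hge
    · exact Or.inl (Or.inl ⟨hYE, by omega⟩)
    rcases Nat.lt_or_ge (M.E \ X).ncard (m + 2) with hlt2 | hge2
    · -- size `m + 1`: `X` has nullity `1`
      have hm1 : (M.E \ X).ncard = m + 1 := by omega
      have hXcard : X.encard = M.eRank + 1 := by
        have hR : M.eRank ≠ ⊤ := (M.eRank_ne_top_iff).2 inferInstance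
        rw [hcastY, hm1] at hsum
        have hsum' : X.encard + ((m + 1 : ℕ) : ℕ∞) = (M.eRank + 1) + ((m + 1 : ℕ) : ℕ∞) := by
          rw [hsum]; push_cast; ring
        exact (ENat.add_le_add_iff_right (by simp)).1 hsum'.le |>.antisymm
          ((ENat.add_le_add_iff_right (by simp)).1 hsum'.ge)
      exact Or.inl (Or.inr ⟨hYE, hm1,
        diff_inter_nonempty_or_of_spanning_of_encard_succ hX.2 hXcard h1 h2 hne⟩)
    · -- size `m + 2 = d`: `X` is a basis
      have hm2 : (M.E \ X).ncard = m + 2 := by omega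
      have hXcard : X.encard = M.eRank := by
        rw [hcastY, hm2] at hsum
        exact (ENat.add_le_add_iff_right (by simp)).1 hsum.le |>.antisymm
          ((ENat.add_le_add_iff_right (by simp)).1 hsum.ge)
      exact Or.inr ⟨hYE, hm2, diff_inter_nonempty_of_spanning_of_encard hX.1 hX.2 hXcard h1,
        diff_inter_nonempty_of_spanning_of_encard hX.1 hX.2 hXcard h2⟩
  have hmain : {X : Set α | X ⊆ M.E ∧ M.eRk X = M.eRank}.ncard ≤ Y₀.ncard + Y₁.ncard + Y₂.ncard := by
    calc {X : Set α | X ⊆ M.E ∧ M.eRk X = M.eRank}.ncard ≤ (Y₀ ∪ Y₁ ∪ Y₂).ncard :=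
          Set.ncard_le_ncard_of_injOn _ hmaps hinj ((hfin₀.union hfin₁).union hfin₂)
      _ ≤ (Y₀ ∪ Y₁).ncard + Y₂.ncard := Set.ncard_union_le _ _
      _ ≤ Y₀.ncard + Y₁.ncard + Y₂.ncard := by
          have := Set.ncard_union_le Y₀ Y₁
          omega
  -- the three counts
  have h₀ : Y₀.ncard ≤ ∑ j ∈ Finset.range (m + 1), n.choose j := ncard_subsets_ncard_le E' m
  have h₁ : Y₁.ncard + (E' \ (hT1f.toFinset ∪ hT2f.toFinset)).card.choose (m + 1) = n.choose (m + 1) := by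
    rw [hY₁, ncard_subsets_ncard_eq_filter E' (m + 1)
      (fun Y : Set α => (Y ∩ T₁).Nonempty ∨ (Y ∩ T₂).Nonempty)]
    have hcongr : (E'.powersetCard (m + 1)).filter
        (fun s : Finset α => ((s : Set α) ∩ T₁).Nonempty ∨ ((s : Set α) ∩ T₂).Nonempty) =
        (E'.powersetCard (m + 1)).filter
        (fun s : Finset α => (s ∩ hT1f.toFinset).Nonempty ∨ (s ∩ hT2f.toFinset).Nonempty) := by
      apply Finset.filter_congr
      intro s _
      simp only [← Finset.coe_nonempty, Finset.coe_inter, hS1, hS2]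
    rw [hcongr]
    exact card_filter_meets_one E' _ _ (m + 1)
  have h₂ : Y₂.ncard + (E' \ hT1f.toFinset).card.choose (m + 2) + (E' \ hT2f.toFinset).card.choose (m + 2)
      = n.choose (m + 2) + (E' \ (hT1f.toFinset ∪ hT2f.toFinset)).card.choose (m + 2) := by
    rw [hY₂, ncard_subsets_ncard_eq_filter E' (m + 2)
      (fun Y : Set α => (Y ∩ T₁).Nonempty ∧ (Y ∩ T₂).Nonempty)]
    have hcongr : (E'.powersetCard (m + 2)).filter
        (fun s : Finset α => ((s : Set α) ∩ T₁).Nonempty ∧ ((s : Set α) ∩ T₂).Nonempty) =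
        (E'.powersetCard (m + 2)).filter
        (fun s : Finset α => (s ∩ hT1f.toFinset).Nonempty ∧ (s ∩ hT2f.toFinset).Nonempty) := by
      apply Finset.filter_congr
      intro s _
      simp only [← Finset.coe_nonempty, Finset.coe_inter, hS1, hS2]
    rw [hcongr]
    exact card_filter_meets_two E' _ _ (m + 2)
  -- the cardinalities of the differences
  have hd1 : (E' \ hT1f.toFinset).card = n - 3 := by rw [Finset.card_sdiff_of_subset hS1E, hc1']
  have hd2 : (E' \ hT2f.toFinset).card = n - 3 := by rw [Finset.card_sdiff_of_subset hS2E, hc2']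
  have hdU : (E' \ (hT1f.toFinset ∪ hT2f.toFinset)).card = n - (hT1f.toFinset ∪ hT2f.toFinset).card :=
    Finset.card_sdiff_of_subset hSU
  have hm6 : (n - 6).choose (m + 1) ≤ (n - (hT1f.toFinset ∪ hT2f.toFinset).card).choose (m + 1) :=
    Nat.choose_le_choose _ (by omega)
  have hm5 : (n - (hT1f.toFinset ∪ hT2f.toFinset).card).choose (m + 2) ≤ (n - 5).choose (m + 2) :=
    Nat.choose_le_choose _ (by omega)
  rw [hd1, hd2, hdU] at h₂
  rw [hdU] at h₁
  have hsum : ∑ j ∈ Finset.range (m + 2 + 1), n.choose j =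
      (∑ j ∈ Finset.range (m + 1), n.choose j) + n.choose (m + 1) + n.choose (m + 2) := by
    rw [show m + 2 + 1 = m + 1 + 1 + 1 by ring, Finset.sum_range_succ, Finset.sum_range_succ]
  rw [show m + 2 - 1 = m + 1 by omega, hsum]
  omega


end Matroid

end PercRepro
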